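import Mathlib
import Summits.ValiantsHypothesis.ValiantsHypothesis.Theorems.ValuativeGCTValuativeFlipTridiagonalSubmersion

/-!
# Spanning certificates at two quaternary pencils: the differential of `det` is onto the
# quaternary quadrics at `!![x₀, x₁; x₂, x₃]` and onto the quaternary cubics at
# `!![x₀, x₁, x₂; x₃, x₀, x₁; 0, x₂, x₃]`

Crux `ValuativeGCT.ValuativeFlip` (stmt-ValiantsHypothesis-12624), wall-breaker axis D
("det-orbit-closure multiplicity bounds for detCensus", seat k3 gen 1 / 3).  Inputs of the `k`-ary
pencil density criterion (`…PencilDensity`,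
`algebraicIndependent_coeff_det_pencil_of_certificate`) for the two cells `(k, m) = (4, 2)` and
`(4, 3)` of the few-letter table of `Det_m`:

* `quaternaryQuadricPencil_certificate` — at `M = !![x₀, x₁; x₂, x₃]` (adjugate
  `!![x₃, -x₁; -x₂, x₀]`) the sixteen products `x_t · adj(M)_{ji}` are, up to sign, the ten
  quadratic monomials: the differential of `det : Mat₂(ℂ⁴*) → Sym² ℂ⁴` at `M` is onto.
* `quaternaryCubicPencil_certificate` — at `M = !![x₀, x₁, x₂; x₃, x₀, x₁; 0, x₂, x₃]` the `36`
  products `x_t · adj(M)_{ji}` span all `20` cubic monomials; each monomial is an explicit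
  `ℤ`-combination of at most four products (`quaternaryCubic_products_span`; found by exact
  rational linear algebra over the `36 × 20` coefficient matrix, seat folder `compute/search3c.py`;
  symmetric pencils — circulant, Toeplitz, Hankel — have rank only `16`).  So the differential of
  `det : Mat₃(ℂ⁴*) → Sym³ ℂ⁴` at `M` is onto: the density half of the classical theorem that the
  general cubic surface is determinantal (Grassmann 1855, Clebsch 1866; Dickson 1921 §9;
  Beauville 2000 Cor. 6.4), by a finite certificate.

The consequences (every quaternary quadric / cubic is border-determinantal, `Det_2` has no
equations, `K_3 = a_λ` on `≤ 4` rows, no valuative flip on `≤ 4`-row shapes at `m ≤ 3`) are drawn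
in `…QuaternaryCubicsBorderDeterminantal`.

References: L. E. Dickson, Trans. AMS 22 (1921) 167–179, §§8–9; A. Beauville, *Determinantal
hypersurfaces*, Michigan Math. J. 48 (2000) Cor. 6.4.
-/

-- `Summit.ValiantsHypothesis.ValiantsHypothesis.…` is the tree's mandated single-conjunct layout (Sub = Summit).
set_option linter.dupNamespace false

namespace Summit.ValiantsHypothesis.ValiantsHypothesis.Theorems.ValuativeFlip

open scoped BigOperators Matrix
open Finset
open MvPolynomial
open Literature.NumberTheory.DiophantineGeometry Literature.Computability.AlgebraicComplexity

noncomputable section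

/-! ## The two quaternary pencils (file-local notation) -/

/-- `A₄₃`: the coefficient tensor of the quaternary cubic pencil `!![x₀, x₁, x₂; x₃, x₀, x₁; 0, x₂, x₃]`. -/
local notation3 (prettyPrint := false) "A₄₃" => (fun v : Fin 4 × Fin 3 × Fin 3 =>
  (![![(Pi.single 0 1 : Fin 4 → ℂ), Pi.single 1 1, Pi.single 2 1],
     ![Pi.single 3 1, Pi.single 0 1, Pi.single 1 1],
     ![0, Pi.single 2 1, Pi.single 3 1]] : Fin 3 → Fin 3 → Fin 4 → ℂ) v.2.1 v.2.2 v.1)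

/-- `F₄₃`: the `36` products `x_t · adj(M)_{ji}` at the quaternary cubic pencil, written out. -/
local notation3 (prettyPrint := false) "F₄₃" => (fun v : Fin 4 × Fin 3 × Fin 3 =>
  (MvPolynomial.X v.1 : MvPolynomial (Fin 4) ℂ) *
    (!![MvPolynomial.X 0 * MvPolynomial.X 3 - MvPolynomial.X 1 * MvPolynomial.X 2,
          MvPolynomial.X 2 ^ 2 - MvPolynomial.X 1 * MvPolynomial.X 3,
          MvPolynomial.X 1 ^ 2 - MvPolynomial.X 0 * MvPolynomial.X 2;
        -(MvPolynomial.X 3 ^ 2), MvPolynomial.X 0 * MvPolynomial.X 3,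
          MvPolynomial.X 2 * MvPolynomial.X 3 - MvPolynomial.X 0 * MvPolynomial.X 1;
        MvPolynomial.X 2 * MvPolynomial.X 3, -(MvPolynomial.X 0 * MvPolynomial.X 2),
          MvPolynomial.X 0 ^ 2 - MvPolynomial.X 1 * MvPolynomial.X 3] :
      Matrix (Fin 3) (Fin 3) (MvPolynomial (Fin 4) ℂ)) v.2.2 v.2.1)

/-- `A₄₂`: the coefficient tensor of the quaternary quadric pencil `!![x₀, x₁; x₂, x₃]`. -/
local notation3 (prettyPrint := false) "A₄₂" => (fun v : Fin 4 × Fin 2 × Fin 2 =>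
  (![![(Pi.single 0 1 : Fin 4 → ℂ), Pi.single 1 1], ![Pi.single 2 1, Pi.single 3 1]] :
    Fin 2 → Fin 2 → Fin 4 → ℂ) v.2.1 v.2.2 v.1)

/-- `F₄₂`: the `16` products `x_t · adj(M)_{ji}` at the quaternary quadric pencil, written out. -/
local notation3 (prettyPrint := false) "F₄₂" => (fun v : Fin 4 × Fin 2 × Fin 2 =>
  (MvPolynomial.X v.1 : MvPolynomial (Fin 4) ℂ) *
    (!![MvPolynomial.X 3, -MvPolynomial.X 1; -MvPolynomial.X 2, MvPolynomial.X 0] :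
      Matrix (Fin 2) (Fin 2) (MvPolynomial (Fin 4) ℂ)) v.2.2 v.2.1)

/-! ## Spanning certificates -/

section Certificates

/-- Membership in a span from an explicit finite combination (bookkeeping for the certificates).
[folklore] -/
theorem mem_span_range_of_eq_list_sum {R M ι : Type*} [Semiring R] [AddCommMonoid M] [Module R M]
    (F : ι → M) (l : List (R × ι)) (p : M) (h : p = (l.map fun ci => ci.1 • F ci.2).sum) :
    p ∈ Submodule.span R (Set.range F) := by
  rw [h]
  refine list_sum_mem fun x hx => ?_
  obtain ⟨ci, _, rfl⟩ := List.mem_map.mp hx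
  exact Submodule.smul_mem _ _ (Submodule.subset_span ⟨ci.2, rfl⟩)

/-- A degree-`d` exponent vector on four letters, as its four exponents: the monomial is
`x₀^a x₁^b x₂^c x₃^d'` with `a + b + c + d' = d`. [folklore] -/
theorem monomial_fin_four_eq (e : Fin 4 →₀ ℕ) :
    (monomial e (1 : ℂ) : MvPolynomial (Fin 4) ℂ) =
      X 0 ^ (e 0) * X 1 ^ (e 1) * X 2 ^ (e 2) * X 3 ^ (e 3) := by
  have he4 : e = Finsupp.single 0 (e 0) + Finsupp.single 1 (e 1) + Finsupp.single 2 (e 2) +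
      Finsupp.single 3 (e 3) := by
    ext i
    fin_cases i <;> simp
  conv_lhs => rw [he4]
  simp only [X_pow_eq_monomial, monomial_mul, mul_one]

/-- The quaternary cubic pencil is `!![x₀, x₁, x₂; x₃, x₀, x₁; 0, x₂, x₃]`. -/
theorem quaternaryCubicPencil_eq :
    (Matrix.of fun i j : Fin 3 => ∑ t : Fin 4, (X t : MvPolynomial (Fin 4) ℂ) * C (A₄₃ (t, i, j))) =
      !![X 0, X 1, X 2; X 3, X 0, X 1; 0, X 2, X 3] := by
  refine Matrix.ext fun i j => ?_
  fin_cases i <;> fin_cases j <;> simp [Fin.sum_univ_four, Pi.single_apply]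

/-- The adjugate of the quaternary cubic pencil (nine quadrics). -/
theorem quaternaryCubicPencil_adjugate :
    (!![X 0, X 1, X 2; X 3, X 0, X 1; 0, X 2, X 3] :
        Matrix (Fin 3) (Fin 3) (MvPolynomial (Fin 4) ℂ)).adjugate =
      !![X 0 * X 3 - X 1 * X 2, X 2 ^ 2 - X 1 * X 3, X 1 ^ 2 - X 0 * X 2;
         -(X 3 ^ 2), X 0 * X 3, X 2 * X 3 - X 0 * X 1;
         X 2 * X 3, -(X 0 * X 2), X 0 ^ 2 - X 1 * X 3] := by
  rw [Matrix.adjugate_fin_three_of]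
  refine Matrix.ext fun i j => ?_
  fin_cases i <;> fin_cases j <;> simp <;> ring

/-- **The quaternary cubic certificate, monomial by monomial.**  Every cubic monomial
`x₀^a x₁^b x₂^c x₃^d` is a `ℤ`-combination of at most four of the products `F₄₃`. -/
theorem quaternaryCubic_products_span (a b c d : ℕ) (h : a + b + c + d = 3) :
    (X 0 ^ a * X 1 ^ b * X 2 ^ c * X 3 ^ d : MvPolynomial (Fin 4) ℂ) ∈
      Submodule.span ℂ (Set.range F₄₃) := by
  generalize hF : F₄₃ = F
  have hS := mem_span_range_of_eq_list_sum (R := ℂ) F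
  have h3000 : (X 0 ^ 3 : MvPolynomial (Fin 4) ℂ) ∈ Submodule.span ℂ (Set.range F) :=
    hS [((1 : ℂ), (0, 2, 2)), ((1 : ℂ), (1, 1, 1))] _ (by simp [← hF]; ring)
  have h2100 : (X 0 ^ 2 * X 1 : MvPolynomial (Fin 4) ℂ) ∈ Submodule.span ℂ (Set.range F) :=
    hS [((1 : ℂ), (0, 0, 2)), ((-1 : ℂ), (0, 2, 1))] _ (by simp [← hF]; ring)
  have h2010 : (X 0 ^ 2 * X 2 : MvPolynomial (Fin 4) ℂ) ∈ Submodule.span ℂ (Set.range F) :=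
    hS [((-1 : ℂ), (0, 1, 2))] _ (by simp [← hF]; ring)
  have h2001 : (X 0 ^ 2 * X 3 : MvPolynomial (Fin 4) ℂ) ∈ Submodule.span ℂ (Set.range F) :=
    hS [((1 : ℂ), (0, 1, 1))] _ (by simp [← hF]; ring)
  have h1200 : (X 0 * X 1 ^ 2 : MvPolynomial (Fin 4) ℂ) ∈ Submodule.span ℂ (Set.range F) :=
    hS [((-1 : ℂ), (0, 1, 2)), ((1 : ℂ), (0, 2, 0))] _ (by simp [← hF]; ring)
  have h1110 : (X 0 * X 1 * X 2 : MvPolynomial (Fin 4) ℂ) ∈ Submodule.span ℂ (Set.range F) :=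
    hS [((-1 : ℂ), (0, 0, 0)), ((1 : ℂ), (0, 1, 1))] _ (by simp [← hF]; ring)
  have h1101 : (X 0 * X 1 * X 3 : MvPolynomial (Fin 4) ℂ) ∈ Submodule.span ℂ (Set.range F) :=
    hS [((1 : ℂ), (1, 1, 1))] _ (by simp [← hF]; ring)
  have h1020 : (X 0 * X 2 ^ 2 : MvPolynomial (Fin 4) ℂ) ∈ Submodule.span ℂ (Set.range F) :=
    hS [((1 : ℂ), (0, 1, 0)), ((1 : ℂ), (1, 1, 1))] _ (by simp [← hF]; ring)
  have h1011 : (X 0 * X 2 * X 3 : MvPolynomial (Fin 4) ℂ) ∈ Submodule.span ℂ (Set.range F) :=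
    hS [((1 : ℂ), (0, 0, 2))] _ (by simp [← hF]; ring)
  have h1002 : (X 0 * X 3 ^ 2 : MvPolynomial (Fin 4) ℂ) ∈ Submodule.span ℂ (Set.range F) :=
    hS [((-1 : ℂ), (0, 0, 1))] _ (by simp [← hF])
  have h0300 : (X 1 ^ 3 : MvPolynomial (Fin 4) ℂ) ∈ Submodule.span ℂ (Set.range F) :=
    hS [((-1 : ℂ), (0, 0, 0)), ((1 : ℂ), (0, 1, 1)), ((1 : ℂ), (1, 2, 0))] _ (by simp [← hF]; ring)
  have h0210 : (X 1 ^ 2 * X 2 : MvPolynomial (Fin 4) ℂ) ∈ Submodule.span ℂ (Set.range F) :=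
    hS [((-1 : ℂ), (1, 0, 0)), ((1 : ℂ), (1, 1, 1))] _ (by simp [← hF]; ring)
  have h0201 : (X 1 ^ 2 * X 3 : MvPolynomial (Fin 4) ℂ) ∈ Submodule.span ℂ (Set.range F) :=
    hS [((1 : ℂ), (0, 0, 2)), ((-1 : ℂ), (0, 2, 1)), ((-1 : ℂ), (1, 2, 2))] _ (by simp [← hF]; ring)
  have h0120 : (X 1 * X 2 ^ 2 : MvPolynomial (Fin 4) ℂ) ∈ Submodule.span ℂ (Set.range F) :=
    hS [((1 : ℂ), (0, 0, 2)), ((-1 : ℂ), (0, 2, 1)), ((1 : ℂ), (1, 1, 0)), ((-1 : ℂ), (1, 2, 2))] _ (by simp [← hF]; ring)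
  have h0111 : (X 1 * X 2 * X 3 : MvPolynomial (Fin 4) ℂ) ∈ Submodule.span ℂ (Set.range F) :=
    hS [((1 : ℂ), (1, 0, 2))] _ (by simp [← hF]; ring)
  have h0102 : (X 1 * X 3 ^ 2 : MvPolynomial (Fin 4) ℂ) ∈ Submodule.span ℂ (Set.range F) :=
    hS [((-1 : ℂ), (1, 0, 1))] _ (by simp [← hF])
  have h0030 : (X 2 ^ 3 : MvPolynomial (Fin 4) ℂ) ∈ Submodule.span ℂ (Set.range F) :=
    hS [((1 : ℂ), (1, 0, 2)), ((1 : ℂ), (2, 1, 0))] _ (by simp [← hF]; ring)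
  have h0021 : (X 2 ^ 2 * X 3 : MvPolynomial (Fin 4) ℂ) ∈ Submodule.span ℂ (Set.range F) :=
    hS [((1 : ℂ), (2, 0, 2))] _ (by simp [← hF]; ring)
  have h0012 : (X 2 * X 3 ^ 2 : MvPolynomial (Fin 4) ℂ) ∈ Submodule.span ℂ (Set.range F) :=
    hS [((-1 : ℂ), (2, 0, 1))] _ (by simp [← hF])
  have h0003 : (X 3 ^ 3 : MvPolynomial (Fin 4) ℂ) ∈ Submodule.span ℂ (Set.range F) :=
    hS [((-1 : ℂ), (3, 0, 1))] _ (by simp [← hF]; ring)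
  rcases a with _ | _ | _ | _ | a
  all_goals try (exfalso; omega)
  all_goals rcases b with _ | _ | _ | _ | b
  all_goals try (exfalso; omega)
  all_goals rcases c with _ | _ | _ | _ | c
  all_goals try (exfalso; omega)
  all_goals rcases d with _ | _ | _ | _ | d
  all_goals try (exfalso; omega)
  all_goals simp only [zero_add, Nat.reduceAdd, pow_zero, pow_one, one_mul, mul_one]
  all_goals with_reducible assumption

/-- **The quaternary cubic certificate.**  At the pencil `M = !![x₀, x₁, x₂; x₃, x₀, x₁; 0, x₂, x₃]`
every cubic monomial in `x₀, …, x₃` is a `ℤ`-combination of the products `x_t · adj(M)_{ji}`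
(the image of the differential of `det` at `M` is all of `Sym³ ℂ⁴`). [this crux; classical fact:
the general cubic surface is determinantal, Dickson 1921 §9 / Beauville 2000 Cor. 6.4] -/
theorem quaternaryCubicPencil_certificate :
    ∀ e : Fin 4 →₀ ℕ, e.degree = 3 →
      (monomial e (1 : ℂ)) ∈ Submodule.span ℂ (Set.range fun v : Fin 4 × Fin 3 × Fin 3 =>
        (X v.1 : MvPolynomial (Fin 4) ℂ) * (Matrix.of fun i j : Fin 3 =>
          ∑ t : Fin 4, (X t : MvPolynomial (Fin 4) ℂ) * C ((fun v : Fin 4 × Fin 3 × Fin 3 =>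
          (![![(Pi.single 0 1 : Fin 4 → ℂ), Pi.single 1 1, Pi.single 2 1],
             ![Pi.single 3 1, Pi.single 0 1, Pi.single 1 1],
             ![0, Pi.single 2 1, Pi.single 3 1]] : Fin 3 → Fin 3 → Fin 4 → ℂ) v.2.1 v.2.2 v.1) (t, i, j))).adjugate v.2.2 v.2.1) := by
  intro e he
  have hfam : (fun v : Fin 4 × Fin 3 × Fin 3 => (X v.1 : MvPolynomial (Fin 4) ℂ) *
      (Matrix.of fun i j : Fin 3 => ∑ t : Fin 4, (X t : MvPolynomial (Fin 4) ℂ) *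
        C (A₄₃ (t, i, j))).adjugate v.2.2 v.2.1) = F₄₃ := by
    funext v
    rw [quaternaryCubicPencil_eq, quaternaryCubicPencil_adjugate]
  rw [hfam, monomial_fin_four_eq]
  rw [Finsupp.degree_eq_sum, Fin.sum_univ_four] at he
  exact quaternaryCubic_products_span _ _ _ _ he

/-- The quaternary quadric pencil is `!![x₀, x₁; x₂, x₃]`. -/
theorem quaternaryQuadricPencil_eq :
    (Matrix.of fun i j : Fin 2 => ∑ t : Fin 4, (X t : MvPolynomial (Fin 4) ℂ) * C (A₄₂ (t, i, j))) =
      !![X 0, X 1; X 2, X 3] := by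
  refine Matrix.ext fun i j => ?_
  fin_cases i <;> fin_cases j <;> simp [Fin.sum_univ_four, Pi.single_apply]

/-- **The quaternary quadric certificate, monomial by monomial**: every quadratic monomial is,
up to sign, one of the products `F₄₂`. -/
theorem quaternaryQuadric_products_span (a b c d : ℕ) (h : a + b + c + d = 2) :
    (X 0 ^ a * X 1 ^ b * X 2 ^ c * X 3 ^ d : MvPolynomial (Fin 4) ℂ) ∈
      Submodule.span ℂ (Set.range F₄₂) := by
  generalize hF : F₄₂ = F
  have hS := mem_span_range_of_eq_list_sum (R := ℂ) F
  have h2000 : (X 0 ^ 2 : MvPolynomial (Fin 4) ℂ) ∈ Submodule.span ℂ (Set.range F) :=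
    hS [((1 : ℂ), (0, 1, 1))] _ (by simp [← hF]; ring)
  have h1100 : (X 0 * X 1 : MvPolynomial (Fin 4) ℂ) ∈ Submodule.span ℂ (Set.range F) :=
    hS [((1 : ℂ), (1, 1, 1))] _ (by simp [← hF]; ring)
  have h1010 : (X 0 * X 2 : MvPolynomial (Fin 4) ℂ) ∈ Submodule.span ℂ (Set.range F) :=
    hS [((1 : ℂ), (2, 1, 1))] _ (by simp [← hF]; ring)
  have h1001 : (X 0 * X 3 : MvPolynomial (Fin 4) ℂ) ∈ Submodule.span ℂ (Set.range F) :=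
    hS [((1 : ℂ), (3, 1, 1))] _ (by simp [← hF]; ring)
  have h0200 : (X 1 ^ 2 : MvPolynomial (Fin 4) ℂ) ∈ Submodule.span ℂ (Set.range F) :=
    hS [((-1 : ℂ), (1, 1, 0))] _ (by simp [← hF]; ring)
  have h0110 : (X 1 * X 2 : MvPolynomial (Fin 4) ℂ) ∈ Submodule.span ℂ (Set.range F) :=
    hS [((-1 : ℂ), (2, 1, 0))] _ (by simp [← hF]; ring)
  have h0101 : (X 1 * X 3 : MvPolynomial (Fin 4) ℂ) ∈ Submodule.span ℂ (Set.range F) :=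
    hS [((-1 : ℂ), (3, 1, 0))] _ (by simp [← hF]; ring)
  have h0020 : (X 2 ^ 2 : MvPolynomial (Fin 4) ℂ) ∈ Submodule.span ℂ (Set.range F) :=
    hS [((-1 : ℂ), (2, 0, 1))] _ (by simp [← hF]; ring)
  have h0011 : (X 2 * X 3 : MvPolynomial (Fin 4) ℂ) ∈ Submodule.span ℂ (Set.range F) :=
    hS [((-1 : ℂ), (3, 0, 1))] _ (by simp [← hF]; ring)
  have h0002 : (X 3 ^ 2 : MvPolynomial (Fin 4) ℂ) ∈ Submodule.span ℂ (Set.range F) :=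
    hS [((1 : ℂ), (3, 0, 0))] _ (by simp [← hF]; ring)
  rcases a with _ | _ | _ | a
  all_goals try (exfalso; omega)
  all_goals rcases b with _ | _ | _ | b
  all_goals try (exfalso; omega)
  all_goals rcases c with _ | _ | _ | c
  all_goals try (exfalso; omega)
  all_goals rcases d with _ | _ | _ | d
  all_goals try (exfalso; omega)
  all_goals simp only [zero_add, Nat.reduceAdd, pow_zero, pow_one, one_mul, mul_one]
  all_goals with_reducible assumption

/-- **The quaternary quadric certificate.**  At the pencil `!![x₀, x₁; x₂, x₃]` (adjugate
`!![x₃, -x₁; -x₂, x₀]`) the products `x_t · adj_{ji}` are, up to sign, the ten quadratic monomials.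
[this crux; classical: a quadric in four variables has rank `≤ 4`, hence is `ℓ₁ℓ₄ - ℓ₂ℓ₃`] -/
theorem quaternaryQuadricPencil_certificate :
    ∀ e : Fin 4 →₀ ℕ, e.degree = 2 →
      (monomial e (1 : ℂ)) ∈ Submodule.span ℂ (Set.range fun v : Fin 4 × Fin 2 × Fin 2 =>
        (X v.1 : MvPolynomial (Fin 4) ℂ) * (Matrix.of fun i j : Fin 2 =>
          ∑ t : Fin 4, (X t : MvPolynomial (Fin 4) ℂ) * C ((fun v : Fin 4 × Fin 2 × Fin 2 =>
          (![![(Pi.single 0 1 : Fin 4 → ℂ), Pi.single 1 1], ![Pi.single 2 1, Pi.single 3 1]] :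
            Fin 2 → Fin 2 → Fin 4 → ℂ) v.2.1 v.2.2 v.1) (t, i, j))).adjugate v.2.2 v.2.1) := by
  intro e he
  have hfam : (fun v : Fin 4 × Fin 2 × Fin 2 => (X v.1 : MvPolynomial (Fin 4) ℂ) *
      (Matrix.of fun i j : Fin 2 => ∑ t : Fin 4, (X t : MvPolynomial (Fin 4) ℂ) *
        C (A₄₂ (t, i, j))).adjugate v.2.2 v.2.1) = F₄₂ := by
    funext v
    rw [quaternaryQuadricPencil_eq, Matrix.adjugate_fin_two_of]
  rw [hfam, monomial_fin_four_eq]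
  rw [Finsupp.degree_eq_sum, Fin.sum_univ_four] at he
  exact quaternaryQuadric_products_span _ _ _ _ he

end Certificates

end

end Summit.ValiantsHypothesis.ValiantsHypothesis.Theorems.ValuativeFlip
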